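import Summits.CriticalPhenomena.PercolationContinuityZ3.Theorems.PercNearOneGluingNoHeavyLowerTailSunflowerMultiPetalKempeMarkedUnpairedRows
import Summits.CriticalPhenomena.PercolationContinuityZ3.Theorems.PercNearOneGluingNoHeavyLowerTailSunflowerMultiPetalKempeMarkedTIPayers
import Summits.CriticalPhenomena.PercolationContinuityZ3.Theorems.PercNearOneGluingNoHeavyLowerTailSunflowerMultiPetalKempeMarkedTIStepOne
import HarnessLib
import HarnessLib.Audit

/-!
# `NoHeavyLowerTail` (crux stmt-CriticalPhenomena-4575), marked-multigraph layer: the fractional-mark functional `TI_{P,Q}` and the TRANSFER of THEOREM U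

Support file (seat `prim-l12-p2` gen 54; `--supports stmt-CriticalPhenomena-4575`; sequel of `…KempeMarkedUnpairedRows`).  No `sorry`; nothing is asserted about
the crux.  Memo: run/shared/lean/prim/prim-l12/prim-l12-p2/FINDING-g54-UNPAIRED-ALL-D-LAW.md §3; FINDING-g51-TI-HIERARCHY.md §2; FINDING-g53-UNPAIRED-STEP-LAWS.md §1.

The TI HIERARCHY (gen 51): for sets `P, Q` of vertices, `TI_{P,Q}(K;u,v) = Σ_{σ u = 0, σ v = 1} 2^{−i−j}·fC(type σ ⊕ i·e₀ ⊕ j·e₁)` with `i = #{p ∈ P : σ p = 0}`,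
`j = #{q ∈ Q : σ q = 1}` — 'a special point coloured like a terminal is half a mark at that terminal'.  Here `TIw = 2^{|P|+|Q|}·TI_{P,Q}` (integer weights
`2^{|P|−i}·2^{|Q|−j}`), and:
* `TIw_eq_sum_classes`: `TIw(L) = Σ_{(i,j)} 2^{|P|−i}2^{|Q|−j}·T_{Φ_ij}(L⁺^{i·u, j·v})` — each weight class is a filtered two-terminal functional of `L` with `i`
  extra marks at `u` and `j` at `v` (`Φ_ij` = 'exactly `i` points of `P` coloured `0` and `j` of `Q` coloured `1`');
* `peelContract_addMark`, `contractOne_addMark`, `addMark_addMark_comm`: the minors of THEOREM U commute with marks at the terminals;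
* **`TIw_step_unpaired` — THEOREM U FOR `TI_{P,Q}` WITH FAR SPECIAL POINTS**: if `P, Q` avoid `S ∪ {y}`, the unpaired law holds verbatim for `TIw`:
  `2·3^{|S|}·TIw(K.isolate y) + 2·TIw(K.peelContract y S u) + 6·TIw((K.peelContract y (S∖w) w)⁺ᵘ) + Σ_s TIw((K.peelContract y (S∖s) u).contractOne s v)
   ≤ 2·3^{|S|+1}·TIw(K)` — the transfer principle of gen 53 made a kernel-checked theorem (every weight class is a union of rows, and THEOREM U holds row
  by row, `TfunF_step_unpaired`).
-/

namespace Summit.CriticalPhenomena.PercolationContinuityZ3.Theorems.SunflowerPartition.Kempe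

open Finset

/-- `(t ⊕ a·e₀) ⊕ b·e₁ = t ⊕ (a,b,0)`. (finite check) [this work] -/
theorem ctAdd_e0_e1 : ∀ (t : CType) (a b : Fin 3), ctAdd (ctAdd t (a, 0, 0)) (0, b, 0) = ctAdd t (a, b, 0) := by decide


section Counts

variable {V : Type*}

/-- Number of points of `P` coloured `0` (like the terminal `u`). [this work] -/
def iCount (P : Finset V) (σ : V → Fin 3) : ℕ := (P.filter (fun p => σ p = 0)).card

/-- Number of points of `Q` coloured `1` (like the terminal `v`). [this work] -/
def jCount (Q : Finset V) (σ : V → Fin 3) : ℕ := (Q.filter (fun q => σ q = 1)).card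

variable [DecidableEq V]

/-- `iCount` ignores the colours off `P`. [this work] -/
theorem iCount_update (P : Finset V) (σ : V → Fin 3) {z : V} (hz : z ∉ P) (c : Fin 3) : iCount P (Function.update σ z c) = iCount P σ := by
  unfold iCount
  congr 1
  exact filter_congr fun p hp => by rw [Function.update_of_ne (ne_of_mem_of_not_mem hp hz)]

/-- `jCount` ignores the colours off `Q`. [this work] -/
theorem jCount_update (Q : Finset V) (σ : V → Fin 3) {z : V} (hz : z ∉ Q) (c : Fin 3) : jCount Q (Function.update σ z c) = jCount Q σ := by
  unfold jCount
  congr 1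
  exact filter_congr fun q hq => by rw [Function.update_of_ne (ne_of_mem_of_not_mem hq hz)]

omit [DecidableEq V] in
/-- `iCount ≤ |P|`. [this work] -/
theorem iCount_le (P : Finset V) (σ : V → Fin 3) : iCount P σ ≤ P.card := card_filter_le _ _

omit [DecidableEq V] in
/-- `jCount ≤ |Q|`. [this work] -/
theorem jCount_le (Q : Finset V) (σ : V → Fin 3) : jCount Q σ ≤ Q.card := card_filter_le _ _

end Counts

namespace MGraph

variable {V : Type*} [Fintype V] [LinearOrder V] (K : MGraph V)

/-! ## Marks at the terminals commute with the minors of THEOREM U -/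

section Commute

omit [Fintype V] in
/-- Marks at two vertices commute. [this work] -/
theorem addMark_addMark_comm (a b : V) (m n : ℕ) : (K.addMark a m).addMark b n = (K.addMark b n).addMark a m := by
  refine ext' (fun x z => ?_) (fun x => ?_)
  · simp only [mul_addMark]
  · unfold addMark addAtU
    simp only
    ring

omit [Fintype V] in
/-- `mark` of `addMark` at any vertex. [this work] -/
theorem mark_addMark (w : V) (m : ℕ) (a : V) : (K.addMark w m).mark a = K.mark a + (if a = w then m else 0) := by
  unfold addMark addAtU
  simp only

omit [Fintype V] in
/-- Adding marks at a vertex outside `S ∪ {y}` commutes with `peelContract y S x` (the vertex may be the target `x`). [this work] -/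
theorem peelContract_addMark (z y x : V) (S : Finset V) (m : ℕ) (hzy : z ≠ y) (hzS : z ∉ S) :
    (K.addMark z m).peelContract y S x = (K.peelContract y S x).addMark z m := by
  refine ext' (fun a b => ?_) (fun a => ?_)
  · rw [mul_addMark]
    unfold peelContract
    simp only [mul_addMark]
  · rw [mark_addMark]
    unfold peelContract
    simp only [mark_addMark, mul_addMark]
    have hS0 : ∑ s ∈ S, (K.mark s + if s = z then m else 0) = ∑ s ∈ S, K.mark s :=
      sum_congr rfl fun s hs => by rw [if_neg (show ¬(s = z) from fun e => hzS (e ▸ hs)), add_zero]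
    by_cases hdead : a = y ∨ a ∈ S
    · have haz : ¬(a = z) := fun e => by
        rcases hdead with h | h
        · exact hzy (e ▸ h)
        · exact hzS (e ▸ h)
      rw [if_pos hdead, if_pos hdead, if_neg haz, add_zero]
    · rw [if_neg hdead, if_neg hdead]
      by_cases hax : a = x
      · subst hax
        rw [if_pos rfl, if_pos rfl, hS0]
        ring
      · rw [if_neg hax, if_neg hax]

omit [Fintype V] in
/-- Adding marks at a vertex other than `s` commutes with the contraction of `s` (the vertex may be the target). [this work] -/
theorem contractOne_addMark (z s x : V) (m : ℕ) (hzs : z ≠ s) :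
    (K.addMark z m).contractOne s x = (K.contractOne s x).addMark z m := by
  refine ext' (fun a b => ?_) (fun a => ?_)
  · rw [mul_addMark]
    unfold contractOne addAtU isolate addMark addAtU
    simp only [add_zero, ite_self]
  · rw [mark_addMark]
    unfold contractOne addAtU isolate
    simp only [mark_addMark, mul_addMark, if_neg hzs.symm, add_zero]
    by_cases has : a = s
    · subst has
      rw [if_pos rfl, if_neg hzs.symm, add_zero]
      by_cases hax : a = x
      · simp [hax]
      · simp [hax]
    · by_cases hax : a = x
      · subst hax; simp only [if_true, if_neg has]; ring
      · simp only [if_neg hax, if_neg has, add_zero]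

end Commute

/-! ## The fractional-mark functional and its weight classes -/

section TIw

/-- `TIw(K; P,Q; u,v) = 2^{|P|+|Q|}·TI_{P,Q}(K;u,v) = Σ_{σ u = 0, σ v = 1} 2^{|P|−i(σ)}·2^{|Q|−j(σ)}·fC(type σ ⊕ (i(σ), j(σ), 0))`,
`i(σ) = #{p ∈ P : σ p = 0}`, `j(σ) = #{q ∈ Q : σ q = 1}` (FINDING-g51 §2: a special point coloured like a terminal is half a mark at that terminal). [this work] -/
def TIw (P Q : Finset V) (u v : V) : ℤ :=
  ∑ σ ∈ univ.filter (fun σ : V → Fin 3 => σ u = 0 ∧ σ v = 1),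
    2 ^ (P.card - iCount P σ) * 2 ^ (Q.card - jCount Q σ) * fC (ctAdd (K.ctypeM σ) (cap3 (iCount P σ), cap3 (jCount Q σ), 0))

/-- Without special points `TIw` is the two-terminal functional. [this work] -/
theorem TIw_empty (u v : V) : K.TIw ∅ ∅ u v = K.TfunM u v := by
  unfold TIw TfunM iCount jCount
  refine sum_congr rfl fun σ _ => ?_
  simp only [filter_empty, card_empty, Nat.sub_zero, pow_zero, one_mul, cap3_zero, ctAdd_zero_triple]

/-- **Weight-class decomposition**: `TIw(L) = Σ_{(i,j)} 2^{|P|−i}·2^{|Q|−j}·T_{Φ_ij}((L⁺^{i·u})⁺^{j·v})` with `Φ_ij = (iCount = i ∧ jCount = j)`. [this work] -/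
theorem TIw_eq_sum_classes (P Q : Finset V) (u v : V) :
    K.TIw P Q u v = ∑ p ∈ (range (P.card + 1)) ×ˢ (range (Q.card + 1)),
      2 ^ (P.card - p.1) * 2 ^ (Q.card - p.2) *
        ((K.addMark u p.1).addMark v p.2).TfunF (fun σ => iCount P σ = p.1 ∧ jCount Q σ = p.2) u v := by
  set F := univ.filter (fun σ : V → Fin 3 => σ u = 0 ∧ σ v = 1) with hF
  set t := (range (P.card + 1)) ×ˢ (range (Q.card + 1)) with ht
  have hmaps : ∀ σ ∈ F, (iCount P σ, jCount Q σ) ∈ t := fun σ _ => by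
    rw [ht, mem_product, mem_range, mem_range]
    exact ⟨Nat.lt_succ_of_le (iCount_le P σ), Nat.lt_succ_of_le (jCount_le Q σ)⟩
  unfold TIw
  rw [← hF, ← sum_fiberwise_of_maps_to hmaps]
  refine sum_congr rfl fun p hp => ?_
  -- inside the class: constant weights, types with the extra marks
  have hcl : ∀ σ ∈ F.filter (fun σ => (iCount P σ, jCount Q σ) = p),
      2 ^ (P.card - iCount P σ) * 2 ^ (Q.card - jCount Q σ) * fC (ctAdd (K.ctypeM σ) (cap3 (iCount P σ), cap3 (jCount Q σ), 0))
        = 2 ^ (P.card - p.1) * 2 ^ (Q.card - p.2) * fC (((K.addMark u p.1).addMark v p.2).ctypeM σ) := by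
    intro σ hσ
    rw [mem_filter] at hσ
    obtain ⟨hσF, hcls⟩ := hσ
    have hu : σ u = 0 := ((mem_filter.1 (hF ▸ hσF)).2).1
    have hv : σ v = 1 := ((mem_filter.1 (hF ▸ hσF)).2).2
    have hi : iCount P σ = p.1 := (Prod.mk.injEq _ _ _ _ ▸ hcls : iCount P σ = p.1 ∧ jCount Q σ = p.2).1
    have hj : jCount Q σ = p.2 := (Prod.mk.injEq _ _ _ _ ▸ hcls : iCount P σ = p.1 ∧ jCount Q σ = p.2).2
    rw [(K.addMark u p.1).ctypeM_addMark v p.2 σ, K.ctypeM_addMark u p.1 σ, hu, hv, xPart_zero_diag, xPart_one_diag, ctAdd_e0_e1, hi, hj]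
  rw [sum_congr rfl hcl, ← mul_sum]
  congr 1
  unfold TfunF
  rw [hF, filter_filter]
  refine sum_congr (filter_congr fun σ _ => ?_) fun _ _ => rfl
  rw [Prod.mk.injEq]

end TIw

/-! ## THEOREM U for the fractional-mark functional (far special points) -/

section TIStep

/-- **THEOREM U FOR `TI_{P,Q}` (transfer; memo FINDING-g54 §3, FINDING-g53 §1)**: for terminals `u ≠ v`, an unmarked `y` with `mul y u ≠ 0`, `mul y v = 0`,
`S = N(y) ∖ {u,v}` with `|S| ≥ 2`, `w ∈ S`, and special sets `P, Q` disjoint from `S ∪ {y}` (they may contain or touch anything else),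
`2·3^{|S|}·TIw(K.isolate y) + 2·TIw(K.peelContract y S u) + 6·TIw((K.peelContract y (S∖w) w)⁺ᵘ) + Σ_{s∈S} TIw((K.peelContract y (S∖s) u).contractOne s v) ≤ 2·3^{|S|+1}·TIw(K)`
(all with the same `P, Q, u, v`). [this work] -/
theorem TIw_step_unpaired (u v y : V) (huv : u ≠ v) (hyu : y ≠ u) (hyv : y ≠ v) (hmark : K.mark y = 0) (hadj : K.mul y u ≠ 0) (hfar : K.mul y v = 0)
    (S : Finset V) (hS : ∀ w, w ∈ S ↔ (w ≠ u ∧ w ≠ v ∧ w ≠ y ∧ K.mul y w ≠ 0)) (htwo : 2 ≤ S.card) {w : V} (hw : w ∈ S)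
    (P Q : Finset V) (hP : ∀ z, (z = y ∨ z ∈ S) → z ∉ P) (hQ : ∀ z, (z = y ∨ z ∈ S) → z ∉ Q) :
    2 * 3 ^ S.card * (K.isolate y).TIw P Q u v + 2 * (K.peelContract y S u).TIw P Q u v
      + 6 * ((K.peelContract y (S.erase w) w).addMark u 1).TIw P Q u v
      + ∑ s ∈ S, ((K.peelContract y (S.erase s) u).contractOne s v).TIw P Q u v
      ≤ 2 * 3 ^ (S.card + 1) * K.TIw P Q u v := by
  have huS : u ∉ S := fun h => ((hS u).1 h).1 rfl
  have hvS : v ∉ S := fun h => ((hS v).1 h).2.1 rfl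
  have hyS : y ∉ S := fun h => ((hS y).1 h).2.2.1 rfl
  set t := (range (P.card + 1)) ×ˢ (range (Q.card + 1)) with ht
  -- notation for the weight classes
  let Φ : ℕ × ℕ → (V → Fin 3) → Prop := fun p σ => iCount P σ = p.1 ∧ jCount Q σ = p.2
  let wt : ℕ × ℕ → ℤ := fun p => 2 ^ (P.card - p.1) * 2 ^ (Q.card - p.2)
  let Kp : ℕ × ℕ → MGraph V := fun p => (K.addMark u p.1).addMark v p.2
  have hwt : ∀ p, 0 ≤ wt p := fun p => by positivity
  have hΦ : ∀ p z, (z = y ∨ z ∈ S) → ∀ σ c, Φ p (Function.update σ z c) ↔ Φ p σ := fun p z hz σ c => by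
    simp only [Φ, iCount_update P σ (hP z hz) c, jCount_update Q σ (hQ z hz) c]
  -- THEOREM U row class by row class for the marked graphs Kp
  have hE : ∀ p ∈ t,
      wt p * (2 * 3 ^ S.card * ((Kp p).isolate y).TfunF (Φ p) u v + 2 * ((Kp p).peelContract y S u).TfunF (Φ p) u v
        + 6 * (((Kp p).peelContract y (S.erase w) w).addMark u 1).TfunF (Φ p) u v
        + ∑ s ∈ S, (((Kp p).peelContract y (S.erase s) u).contractOne s v).TfunF (Φ p) u v)
      ≤ wt p * (2 * 3 ^ (S.card + 1) * (Kp p).TfunF (Φ p) u v) := by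
    intro p _
    refine mul_le_mul_of_nonneg_left ?_ (hwt p)
    have hmark' : (Kp p).mark y = 0 := by
      simp only [Kp, mark_addMark, if_neg hyv, if_neg hyu, add_zero, hmark]
    have hadj' : (Kp p).mul y u ≠ 0 := by simpa only [Kp, mul_addMark] using hadj
    have hfar' : (Kp p).mul y v = 0 := by simpa only [Kp, mul_addMark] using hfar
    have hS' : ∀ z, z ∈ S ↔ (z ≠ u ∧ z ≠ v ∧ z ≠ y ∧ (Kp p).mul y z ≠ 0) := fun z => by simpa only [Kp, mul_addMark] using hS z
    exact (Kp p).TfunF_step_unpaired (Φ p) y u v S huv hyu hyv hmark' hadj' hfar' hS' htwo hw (hΦ p)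
  have hsum := sum_le_sum hE
  -- the minors of Kp are the marked minors of K
  have e1 : ∀ p, (Kp p).isolate y = ((K.isolate y).addMark u p.1).addMark v p.2 := fun p => by
    simp only [Kp, isolate_addMark _ v y hyv.symm, isolate_addMark _ u y hyu.symm]
  have e2 : ∀ p, (Kp p).peelContract y S u = ((K.peelContract y S u).addMark u p.1).addMark v p.2 := fun p => by
    simp only [Kp, peelContract_addMark _ v y u S _ hyv.symm hvS, peelContract_addMark _ u y u S _ hyu.symm huS]
  have e3 : ∀ p, ((Kp p).peelContract y (S.erase w) w).addMark u 1
      = ((((K.peelContract y (S.erase w) w).addMark u 1)).addMark u p.1).addMark v p.2 := fun p => by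
    simp only [Kp]
    rw [peelContract_addMark _ v y w (S.erase w) _ hyv.symm (fun h => hvS (mem_erase.1 h).2),
      peelContract_addMark _ u y w (S.erase w) _ hyu.symm (fun h => huS (mem_erase.1 h).2),
      addMark_addMark_comm _ v u, addMark_addMark_comm _ u u p.1 1]
  have e4 : ∀ p, ∀ s ∈ S, ((Kp p).peelContract y (S.erase s) u).contractOne s v
      = ((((K.peelContract y (S.erase s) u).contractOne s v)).addMark u p.1).addMark v p.2 := fun p s hs => by
    have hsu : s ≠ u := fun e => huS (e ▸ hs)
    have hsv : s ≠ v := fun e => hvS (e ▸ hs)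
    simp only [Kp]
    rw [peelContract_addMark _ v y u (S.erase s) _ hyv.symm (fun h => hvS (mem_erase.1 h).2),
      peelContract_addMark _ u y u (S.erase s) _ hyu.symm (fun h => huS (mem_erase.1 h).2),
      contractOne_addMark _ v s v _ hsv.symm, contractOne_addMark _ u s v _ hsu.symm]
  have e4' : ∀ p, ∑ s ∈ S, (((Kp p).peelContract y (S.erase s) u).contractOne s v).TfunF (Φ p) u v
      = ∑ s ∈ S, ((((K.peelContract y (S.erase s) u).contractOne s v).addMark u p.1).addMark v p.2).TfunF (Φ p) u v :=
    fun p => sum_congr rfl fun s hs => by rw [e4 p s hs]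
  -- rewrite both sides as sums over the weight classes
  rw [K.TIw_eq_sum_classes P Q u v, (K.isolate y).TIw_eq_sum_classes P Q u v, (K.peelContract y S u).TIw_eq_sum_classes P Q u v,
    ((K.peelContract y (S.erase w) w).addMark u 1).TIw_eq_sum_classes P Q u v,
    sum_congr rfl (fun s _ => ((K.peelContract y (S.erase s) u).contractOne s v).TIw_eq_sum_classes P Q u v)]
  rw [← ht, sum_comm, mul_sum, mul_sum, mul_sum, mul_sum, ← sum_add_distrib, ← sum_add_distrib, ← sum_add_distrib]
  refine le_trans (le_of_eq ?_) (le_trans hsum (le_of_eq ?_))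
  · refine sum_congr rfl fun p _ => ?_
    rw [e1 p, e2 p, e3 p, e4' p, ← mul_sum]
    simp only [wt, Φ]
    ring
  · refine sum_congr rfl fun p _ => ?_
    simp only [Kp, wt, Φ]
    ring

end TIStep

end MGraph

end Summit.CriticalPhenomena.PercolationContinuityZ3.Theorems.SunflowerPartition.Kempe
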